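import Mathlib
import HarnessLib
import Summits.HodgeConjecture.FermatCycles.CubicDoorSixtyNinePrym

/-!
# Fermat cycles — `(10, 69)`: kernel appendix to ENGINE v13 'LINES' (the FAMILY-P lines of `ℙ⁴_{I₃}`)

HONEST FRAMING: explicit algebraic cycles for specific Hodge classes on Fermat/Delsarte varieties;
residual open instances listed; no claim on general Hodge.

Cell `pub-hfermat`, track FIND-THE-CLASS, seat ftc-engine gen-16; companion of the cell memo `ftc/certs/W69/LINES.md`
(ENGINE v13), which re-derives FAMILY-H §H.21 THEOREM Λ (the FAMILY-P LINES of the four residual-quadric classes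
`I₁ … I₄` of the cubic door `W₆₉`) by an independent method.  A line `L ⊂ ℙ⁴_I`, `ℓ = a·λ + b·μ`, is FAMILY-P when
`f_I(ℓ) = −det A′_I(ℓ)·D₀′_I(ℓ)²` is a non-zero constant times a sixth power of a binary quartic.  THEOREM Λ says:
none for `I₁, I₂, I₄`; for `I₃` exactly the lines `L(α, a) = {y₆ = α y₃, y₉ = α y₁₀, y₄ = a y₃}` (`α, a ≠ 0`,
`α a² ≠ 1`), all inside the quadric cone `K = {y₆ y₁₀ = y₃ y₉}` on which the door classes restrict to zero.

What is KERNEL-CHECKED here (pure commutative algebra over `ℤ`, with the polynomials `detA₃`, `D0₃` of the tree file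
`CubicDoorSixtyNinePrym.lean`, i.e. `det A′_{I₃}`, `D₀′_{I₃}` of `ftc/certs/W69/disc.json`):
* the POSITIVE half of THEOREM Λ for `I₃`: on `L(α, a)` parametrised by `(y₃,y₄,y₆,y₉,y₁₀) = (λ, aλ, αλ, αμ, μ)`,
  `−det A′ = (αa² − 1)² λ⁴ μ²`, `D₀′ = −aα(αa² − 1)² λ⁷ μ²`, hence
  `f_{I₃}(ℓ) = a² α² · ((αa² − 1)·λ³μ)⁶` — a constant times a sixth power (non-zero iff `a α ≠ 0`, `αa² ≠ 1`);
* the identity behind FAMILY-H §H.22 THEOREM Z (i) for `I₃` and behind the `J`-family of PROPOSITION E: on every join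
  line `(λ, aλ, αλ, βμ, μ)` of a point of `M = {y₃ = y₄ = y₆ = 0}` with a point of `{y₉ = y₁₀ = 0}`,
  `−det A′ = ((1 + a²β)² − 4a²α)·λ⁴μ²` (a constant times a square: every such line is an η-line, and it lies in
  `{det A′ = 0}` iff `(1 + a²β)² = 4a²α`).
Nothing here is a cycle, a class or a Hodge-theoretic statement: `(10,69)` is OPEN.  No `sorry`.
References: [Shioda1979HodgeFermat] Thm I (characters of Fermat varieties); cell files `ftc/certs/W69/LINES.md`,
`ftc/candidates/FAMILY-H_cubic-door-69.md` §H.21–H.22.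
-/

namespace Summit.HodgeConjecture.FermatCycles.FamilyPLines

open Summit.HodgeConjecture.FermatCycles.CubicDoorSixtyNinePrym

/-- Join lines of `M = {y₃=y₄=y₆=0}` and `{y₉=y₁₀=0}` (`y₄ = a y₃`, `y₆ = α y₃`, `y₉ = β y₁₀`): `−det A′_{I₃}` restricted to the
line is `((1 + a²β)² − 4a²α)·λ⁴μ²` — a constant times a square (FAMILY-H §H.21 PROP. E family `J`; §H.22 THEOREM Z (i), `I₃`). [folklore] -/
theorem neg_detA₃_on_join (l m a α β : ℤ) :
    -(detA₃ l (a * l) (α * l) (β * m) m) = ((1 + a ^ 2 * β) ^ 2 - 4 * a ^ 2 * α) * l ^ 4 * m ^ 2 := by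
  unfold detA₃; ring

/-- On the line `L(α, a) = {y₆ = α y₃, y₉ = α y₁₀, y₄ = a y₃}` (the case `β = α`, inside the cone `K`):
`−det A′_{I₃}(ℓ) = (αa² − 1)²·λ⁴μ²`. [folklore] -/
theorem neg_detA₃_on_L (l m a α : ℤ) :
    -(detA₃ l (a * l) (α * l) (α * m) m) = (α * a ^ 2 - 1) ^ 2 * l ^ 4 * m ^ 2 := by
  unfold detA₃; ring

/-- On `L(α, a)`: `D₀′_{I₃}(ℓ) = −aα(αa² − 1)²·λ⁷μ²`. [folklore] -/
theorem D0₃_on_L (l m a α : ℤ) :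
    D0₃ l (a * l) (α * l) (α * m) m = -(a * α * (α * a ^ 2 - 1) ^ 2) * l ^ 7 * m ^ 2 := by
  unfold D0₃; ring

/-- THEOREM Λ, positive half for `I₃` (ENGINE v13 'LINES' / FAMILY-H §H.21 (e)): on `L(α, a)` the sextic-cover function
`f_{I₃}(ℓ) = −det A′_{I₃}(ℓ)·D₀′_{I₃}(ℓ)²` is the constant `a²α²` times the sixth power of the quartic `(αa² − 1)·λ³μ`;
so for `aα ≠ 0`, `αa² ≠ 1` the line `L(α, a)` is a FAMILY-P line (the cover `w⁶ = f` splits over it). [folklore] -/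
theorem f₃_on_L_sixth_power (l m a α : ℤ) :
    -(detA₃ l (a * l) (α * l) (α * m) m) * (D0₃ l (a * l) (α * l) (α * m) m) ^ 2
      = a ^ 2 * α ^ 2 * ((α * a ^ 2 - 1) * l ^ 3 * m) ^ 6 := by
  have h1 := neg_detA₃_on_L l m a α
  have h2 := D0₃_on_L l m a α
  rw [h2]
  have h3 : -(detA₃ l (a * l) (α * l) (α * m) m) * (-(a * α * (α * a ^ 2 - 1) ^ 2) * l ^ 7 * m ^ 2) ^ 2
      = ((α * a ^ 2 - 1) ^ 2 * l ^ 4 * m ^ 2) * (-(a * α * (α * a ^ 2 - 1) ^ 2) * l ^ 7 * m ^ 2) ^ 2 := by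
    rw [← h1]
  rw [h3]; ring

/-- The lines `L(α, a)` lie in the quadric cone `K = {y₆ y₁₀ = y₃ y₉}` (door-dead carrier, PRYM-DETECT §6.3): pointwise on the
parametrisation `(λ, aλ, αλ, αμ, μ)`. [folklore] -/
theorem L_in_K (l m α : ℤ) : (α * l) * m = l * (α * m) := by ring

end Summit.HodgeConjecture.FermatCycles.FamilyPLines
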